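import Literature.NumberTheory.ModularForms.GammaTranslatesSetup
import Literature.NumberTheory.EllipticCurves.KleinJIntegralQExpansion
import HarnessLib

/-!
# From `Γ(N)` to `Γ₁(N²)`: `g ↦ g ∣_k diag(N, 1)` and the cusp form `(g ∣ diag(N,1)) · Δ`

Topic `Literature/NumberTheory/ModularForms`; namespace `Literature.NumberTheory.ModularForms`.
For the bounded-denominators half of the `q`-expansion principle for translates
(`GammaTranslatesBounded`, feeding Sturm's congruence theorem) we move a form `g ∈ M_k(Γ(N))`
(`q_N`-expansion `∑ aₙ q_Nⁿ`) to `W = g ∣_k diag(N,1) = N^{k-1} g(Nτ) ∈ M_k(Γ₁(N²))`, whose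
`q`-expansion (period `1`) is `N^{k-1} ∑ aₙ qⁿ` (Shimura 1971, Prop. 2.4-type conjugation
`diag(N,1) Γ₁(N²) diag(N,1)⁻¹ ⊆ Γ(N)`; Diamond–Shurman §5.7 `[α_d]_k`, Ex. 1.5.6), and multiply by
`Δ` to obtain a cusp form on `Γ₁(N²)`, where the tree's Deligne–Serre integral spanning set lives.

* `exists_Gamma_conj_upperTri` — `diag(N,1) γ = γ'' diag(N,1)` with `γ'' ∈ Γ(N)` for
  `γ ∈ Γ₁(N²)`;
* `levelRaise_mem` — `W ∈ formSpace Γ₁(N²) k` (invariance by the conjugation, boundedness of all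
  `SL₂(ℤ)`-translates through the tree's Hermite decomposition `diag(N,1) g = γ'(A B; 0 D)`);
* `qExpansion_coeff_levelRaise` — `coeff n (qExpansion 1 W) = N^{k-1} coeff n (qExpansion N g)`;
* `levelRaiseCusp` — the cusp form `W · Δ ∈ S_{k+12}(Γ₁(N²))` and `qExpansion_levelRaiseCusp`:
  `qExpansion 1 (W Δ) = qExpansion 1 W · (X · formalDeltaUnit)` (`Δ = q ∏(1-qⁿ)²⁴ ∈ ℤ⟦q⟧`, tree
  `qExpansion_discriminant`).

Everything is proved; the definitions are `levelRaise` and `levelRaiseCusp` (no named fact).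

## References

* [ShimuraIATAF1971] G. Shimura, *Introduction to the arithmetic theory of automorphic
  functions*, Princeton (1971), §3.5 (conjugation of congruence subgroups), Thm. 3.52.
* [DiamondShurman2005] F. Diamond, J. Shurman, *A First Course in Modular Forms*, GTM 228
  (2005), §5.7 (`[α_d]_k : M_k(Γ₁(N)) → M_k(Γ₁(Nd))`), Ex. 1.5.6.
-/

noncomputable section

namespace Literature.NumberTheory.ModularForms

open scoped MatrixGroups Real CongruenceSubgroup Matrix ModularForm Topology Manifold
open UpperHalfPlane hiding I
open Complex Filter Function ModularForm PowerSeries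
open Literature.NumberTheory.EllipticCurves.ModularForms (formSpace mem_formSpace
  mem_formSpace_iff coe_mem_formSpace mul_mem_formSpace formSpace_mono
  mdifferentiable_of_mem_formSpace slash_eq_of_mem_formSpace isBoundedAtImInfty_slash_of_mem_formSpace
  upperTri val_upperTri slash_upperTri_apply exists_hermite tendsto_upperTri_smul coe_upperTri_smul
  hermiteA hermiteD)
open Literature.NumberTheory.EllipticCurves (formalDeltaUnit qExpansion_discriminant)

section LevelRaise

variable (N : ℕ) [NeZero N] {k : ℤ}

/-- **Conjugation**: for `γ = (a b; c d) ∈ Γ₁(N²)`, `diag(N,1) γ = γ'' diag(N,1)` with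
`γ'' = (a Nb; c/N d) ∈ Γ(N)`. [cite: ShimuraIATAF1971, §3.5] -/
theorem exists_Gamma_conj_upperTri {γ : SL(2, ℤ)} (hγ : γ ∈ CongruenceSubgroup.Gamma1 (N ^ 2)) :
    ∃ γ'' : SL(2, ℤ), γ'' ∈ CongruenceSubgroup.Gamma N ∧
      (upperTri N 1 0 : GL (Fin 2) ℝ) * (γ : GL (Fin 2) ℝ) = (γ'' : GL (Fin 2) ℝ) * upperTri N 1 0 := by
  rw [CongruenceSubgroup.Gamma1_mem] at hγ
  obtain ⟨ha, hd, hc⟩ := hγ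
  have hdet : γ 0 0 * γ 1 1 - γ 0 1 * γ 1 0 = 1 := by
    have := Matrix.det_fin_two (γ : Matrix (Fin 2) (Fin 2) ℤ)
    rw [γ.det_coe] at this
    linarith
  obtain ⟨c', hc'⟩ : ((N : ℤ) ^ 2) ∣ γ 1 0 := by
    have := (ZMod.intCast_zmod_eq_zero_iff_dvd (γ 1 0) (N ^ 2)).mp hc
    exact_mod_cast this
  let γ'' : SL(2, ℤ) := ⟨!![γ 0 0, N * γ 0 1; N * c', γ 1 1], by
    rw [Matrix.det_fin_two_of]
    linear_combination hdet + γ 0 1 * hc'⟩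
  have hN1 : ∀ x : ℤ, ((N : ℤ) ^ 2 ∣ x - 1) → ((x : ZMod N)) = 1 := by
    intro x hx
    have h1 : ((N : ℤ)) ∣ x - 1 := (dvd_pow_self (N : ℤ) two_ne_zero).trans hx
    have := (ZMod.intCast_eq_intCast_iff_dvd_sub 1 x N).mpr h1
    simpa using this.symm
  have ha' : ((N : ℤ) ^ 2) ∣ γ 0 0 - 1 := by
    have := (ZMod.intCast_eq_intCast_iff_dvd_sub 1 (γ 0 0) (N ^ 2)).mp (by simpa using ha.symm)
    exact_mod_cast this
  have hd' : ((N : ℤ) ^ 2) ∣ γ 1 1 - 1 := by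
    have := (ZMod.intCast_eq_intCast_iff_dvd_sub 1 (γ 1 1) (N ^ 2)).mp (by simpa using hd.symm)
    exact_mod_cast this
  refine ⟨γ'', ?_, ?_⟩
  · rw [CongruenceSubgroup.Gamma_mem]
    refine ⟨?_, ?_, ?_, ?_⟩
    · show (((!![γ 0 0, N * γ 0 1; N * c', γ 1 1] : Matrix (Fin 2) (Fin 2) ℤ) 0 0 : ℤ) : ZMod N) = 1
      simpa using hN1 _ ha'
    · show (((!![γ 0 0, N * γ 0 1; N * c', γ 1 1] : Matrix (Fin 2) (Fin 2) ℤ) 0 1 : ℤ) : ZMod N) = 0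
      simp
    · show (((!![γ 0 0, N * γ 0 1; N * c', γ 1 1] : Matrix (Fin 2) (Fin 2) ℤ) 1 0 : ℤ) : ZMod N) = 0
      simp
    · show (((!![γ 0 0, N * γ 0 1; N * c', γ 1 1] : Matrix (Fin 2) (Fin 2) ℤ) 1 1 : ℤ) : ZMod N) = 1
      simpa using hN1 _ hd'
  · ext i j
    simp only [Matrix.GeneralLinearGroup.coe_mul, val_upperTri]
    have hg : ((γ : GL (Fin 2) ℝ) : Matrix (Fin 2) (Fin 2) ℝ) =
        !![(γ 0 0 : ℝ), (γ 0 1 : ℝ); (γ 1 0 : ℝ), (γ 1 1 : ℝ)] := by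
      ext i j
      fin_cases i <;> fin_cases j <;> rfl
    have hγ'' : ((γ'' : GL (Fin 2) ℝ) : Matrix (Fin 2) (Fin 2) ℝ) =
        !![(γ 0 0 : ℝ), ((N : ℝ) * γ 0 1); ((N : ℝ) * c'), (γ 1 1 : ℝ)] := by
      ext i j
      fin_cases i <;> fin_cases j <;> simp [γ'']
    have hcR : ((γ 1 0 : ℤ) : ℝ) = (N : ℝ) ^ 2 * c' := by exact_mod_cast hc'
    rw [hg, hγ'']
    fin_cases i <;> fin_cases j <;> simp [Matrix.mul_apply, Fin.sum_univ_two, hcR] <;> ring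

variable (k) in
/-- **The level raise `W = g ∣_k diag(N,1) = N^{k-1} g(Nτ)`** (Diamond–Shurman's `[α_N]_k` up to
the normalising power of `N`). [cite: DiamondShurman2005, §5.7] -/
def levelRaise (g : ℍ → ℂ) : ℍ → ℂ := g ∣[k] (upperTri N 1 0 : GL (Fin 2) ℝ)

/-- `W ∈ M_k(Γ₁(N²))` for `g ∈ M_k(Γ(N))`: invariance by `exists_Gamma_conj_upperTri`, holomorphy,
and boundedness of every `W ∣ g = (g ∣ γ') ∣ (A B; 0 D)` (Hermite decomposition, `(A B; 0 D)τ → i∞`).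
[cite: DiamondShurman2005, §5.7 and Ex. 1.5.6] -/
theorem levelRaise_mem {g : ℍ → ℂ} (hg : g ∈ formSpace (CongruenceSubgroup.Gamma N) k) :
    levelRaise N k g ∈ formSpace (CongruenceSubgroup.Gamma1 (N ^ 2)) k := by
  rw [mem_formSpace_iff]
  refine ⟨(mdifferentiable_of_mem_formSpace hg).slash k _, ?_, ?_⟩
  · rintro _ ⟨γ, hγ, rfl⟩
    obtain ⟨γ'', hγ'', hconj⟩ := exists_Gamma_conj_upperTri N hγ
    show (g ∣[k] (upperTri N 1 0 : GL (Fin 2) ℝ)) ∣[k] (γ : GL (Fin 2) ℝ) = g ∣[k] (upperTri N 1 0 : GL (Fin 2) ℝ)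
    rw [← SlashAction.slash_mul, hconj, SlashAction.slash_mul,
      slash_eq_of_mem_formSpace hg (γ := (γ'' : GL (Fin 2) ℝ)) ⟨γ'', hγ'', rfl⟩]
  · intro γ
    obtain ⟨γ', B, h⟩ := exists_hermite N γ
    show IsBoundedAtImInfty ((g ∣[k] (upperTri N 1 0 : GL (Fin 2) ℝ)) ∣[k] (γ : GL (Fin 2) ℝ))
    rw [← SlashAction.slash_mul, h, SlashAction.slash_mul]
    have hmem : g ∣[k] (γ' : GL (Fin 2) ℝ) ∈ formSpace (CongruenceSubgroup.Gamma N) k :=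
      slash_mem_formSpace_Gamma hg γ'
    have hbd : IsBoundedAtImInfty (fun τ : ℍ ↦
        (g ∣[k] (γ' : GL (Fin 2) ℝ)) (upperTri (hermiteA N γ) (hermiteD N γ) B • τ)) := by
      obtain ⟨F, hF⟩ := hmem
      have : Fact (IsCusp OnePoint.infty ((CongruenceSubgroup.Gamma N : Subgroup SL(2, ℤ)) :
          Subgroup (GL (Fin 2) ℝ))) :=
        ⟨Subgroup.isCusp_of_mem_strictPeriods (Nat.cast_pos.mpr (NeZero.pos N)) (natCast_mem_strictPeriods_Gamma N)⟩
      have hb := ModularFormClass.bdd_at_infty F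
      rw [hF] at hb
      exact hb.comp_tendsto (tendsto_upperTri_smul _ _ _)
    have : (g ∣[k] (γ' : GL (Fin 2) ℝ)) ∣[k] upperTri (hermiteA N γ) (hermiteD N γ) B =
        fun τ ↦ ((((hermiteA N γ : ℂ) * (hermiteD N γ)) ^ (k - 1) * ((hermiteD N γ : ℂ)) ^ (-k)) *
          (g ∣[k] (γ' : GL (Fin 2) ℝ)) (upperTri (hermiteA N γ) (hermiteD N γ) B • τ)) := by
      funext τ
      rw [slash_upperTri_apply]
    rw [this]
    exact hbd.const_mul_left _

/-- Pointwise: `W(τ) = N^{k-1} g(Nτ)`, and `q_N(diag(N,1)τ) = q(τ)`. [folklore] -/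
theorem levelRaise_apply (g : ℍ → ℂ) (τ : ℍ) :
    levelRaise N k g τ = (N : ℂ) ^ (k - 1) * g (upperTri N 1 0 • τ) := by
  rw [levelRaise, slash_upperTri_apply]
  simp

omit [NeZero N] in
/-- `q_N(diag(N,1)·τ) = q(τ)`. [folklore] -/
theorem qParam_upperTri_smul [NeZero N] (τ : ℍ) :
    Periodic.qParam (N : ℝ) (upperTri N 1 0 • τ : ℍ) = Periodic.qParam 1 τ := by
  rw [Periodic.qParam, Periodic.qParam, coe_upperTri_smul]
  congr 1
  have hN : (N : ℂ) ≠ 0 := by exact_mod_cast NeZero.ne N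
  push_cast
  field_simp
  ring

/-- **The `q`-expansion of `W`**: `coeff n (qExpansion 1 W) = N^{k-1} · coeff n (qExpansion N g)`
(`g = ∑ aₙ q_Nⁿ` gives `W = N^{k-1} ∑ aₙ qⁿ`, and `q`-expansions of forms on `Γ₁(N²)` are unique).
[cite: DiamondShurman2005, §5.7] -/
theorem qExpansion_coeff_levelRaise {g : ℍ → ℂ} (hg : g ∈ formSpace (CongruenceSubgroup.Gamma N) k)
    (n : ℕ) : (qExpansion 1 (levelRaise N k g)).coeff n = (N : ℂ) ^ (k - 1) * (qExpansion (N : ℝ) g).coeff n := by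
  obtain ⟨W, hW⟩ := levelRaise_mem N hg
  have h1 : (1 : ℝ) ∈ ((CongruenceSubgroup.Gamma1 (N ^ 2) : Subgroup SL(2, ℤ)) :
      Subgroup (GL (Fin 2) ℝ)).strictPeriods := by
    rw [CongruenceSubgroup.strictPeriods_Gamma1]
    exact AddSubgroup.mem_zmultiples _
  -- the series for `g` at `diag(N,1)τ`
  obtain ⟨G, hG⟩ := hg
  have : Fact (IsCusp OnePoint.infty ((CongruenceSubgroup.Gamma N : Subgroup SL(2, ℤ)) :
      Subgroup (GL (Fin 2) ℝ))) :=
    ⟨Subgroup.isCusp_of_mem_strictPeriods (Nat.cast_pos.mpr (NeZero.pos N)) (natCast_mem_strictPeriods_Gamma N)⟩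
  have hsum : ∀ τ : ℍ, HasSum (fun m ↦ ((N : ℂ) ^ (k - 1) * (qExpansion (N : ℝ) g).coeff m) •
      Periodic.qParam 1 τ ^ m) (W τ) := by
    intro τ
    have hb := hasSum_qExpansion (Nat.cast_pos.mpr (NeZero.pos N)) (SlashInvariantFormClass.periodic_comp_ofComplex G
      (natCast_mem_strictPeriods_Gamma N)) (ModularFormClass.holo G) (ModularFormClass.bdd_at_infty G)
      (upperTri N 1 0 • τ)
    rw [hG, qParam_upperTri_smul] at hb
    rw [hW, levelRaise_apply]
    have hb' := hb.mul_left ((N : ℂ) ^ (k - 1))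
    refine hb'.congr_fun fun m ↦ ?_
    simp only [smul_eq_mul, mul_assoc]
  have := ModularFormClass.qExpansion_coeff_unique one_pos h1 hsum n
  rw [hW] at this
  exact this.symm

end LevelRaise

/-! ### The cusp form `W · Δ` on `Γ₁(N²)` -/

section Cusp

variable (N : ℕ) [NeZero N] (k : ℤ)

/-- `Δ` is invariant under `SL₂(ℤ)`. [folklore] -/
theorem discriminant_slash_SL2 (γ : SL(2, ℤ)) :
    ModularForm.discriminant ∣[(12 : ℤ)] γ = ModularForm.discriminant :=
  CuspForm.discriminant.slash_action_eq' _ ⟨γ, rfl⟩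

variable {N k} in
/-- **The cusp form `W · Δ ∈ S_{k+12}(Γ₁(N²))`** attached to `g ∈ M_k(Γ(N))` (`W = g ∣ diag(N,1)`):
bounded times vanishing at every cusp. [cite: DiamondShurman2005, §5.7] -/
def levelRaiseCusp {g : ℍ → ℂ} (hg : g ∈ formSpace (CongruenceSubgroup.Gamma N) k) :
    CuspForm (CongruenceSubgroup.Gamma1 (N ^ 2)) (k + 12) where
  toFun := levelRaise N k g * ModularForm.discriminant
  slash_action_eq' := by
    rintro _ ⟨γ, hγ, rfl⟩
    show (levelRaise N k g * ModularForm.discriminant) ∣[k + 12] γ = _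
    rw [ModularForm.mul_slash_SL2, discriminant_slash_SL2,
      show levelRaise N k g ∣[k] γ = levelRaise N k g from
        slash_eq_of_mem_formSpace (levelRaise_mem N hg) (γ := (γ : GL (Fin 2) ℝ)) ⟨γ, hγ, rfl⟩]
  holo' := (mdifferentiable_of_mem_formSpace (levelRaise_mem N hg)).mul CuspForm.discriminant.holo'
  zero_at_cusps' hc := by
    rw [Subgroup.IsArithmetic.isCusp_iff_isCusp_SL2Z] at hc
    rw [OnePoint.isZeroAt_iff_forall_SL2Z hc]
    intro γ _
    show IsZeroAtImInfty ((levelRaise N k g * ModularForm.discriminant) ∣[k + 12] (γ : GL (Fin 2) ℝ))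
    rw [← ModularForm.SL_slash, ModularForm.mul_slash_SL2, discriminant_slash_SL2]
    exact (isBoundedAtImInfty_slash_of_mem_formSpace (levelRaise_mem N hg) γ).mul_zeroAtFilter
      ModularForm.discriminant_isZeroAtImInfty

variable {N k}

/-- The function of `levelRaiseCusp`. [folklore] -/
@[simp] theorem coe_levelRaiseCusp {g : ℍ → ℂ} (hg : g ∈ formSpace (CongruenceSubgroup.Gamma N) k) :
    (⇑(levelRaiseCusp hg) : ℍ → ℂ) = levelRaise N k g * ModularForm.discriminant := rfl

/-- **`qExpansion 1 (W Δ) = qExpansion 1 W · (X · formalDeltaUnit)`** with the tree's integral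
`q`-expansion `Δ = q ∏ (1 - qⁿ)²⁴` (`qExpansion_discriminant`). [folklore] -/
theorem qExpansion_levelRaiseCusp {g : ℍ → ℂ} (hg : g ∈ formSpace (CongruenceSubgroup.Gamma N) k) :
    qExpansion 1 (⇑(levelRaiseCusp hg)) =
      qExpansion 1 (levelRaise N k g) * (PowerSeries.X * formalDeltaUnit).map (Int.castRingHom ℂ) := by
  rw [coe_levelRaiseCusp, ← qExpansion_discriminant]
  obtain ⟨W, hW⟩ := levelRaise_mem N hg
  have h1 : (1 : ℝ) ∈ ((CongruenceSubgroup.Gamma1 (N ^ 2) : Subgroup SL(2, ℤ)) :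
      Subgroup (GL (Fin 2) ℝ)).strictPeriods := by
    rw [CongruenceSubgroup.strictPeriods_Gamma1]
    exact AddSubgroup.mem_zmultiples _
  have hana : AnalyticAt ℂ (cuspFunction 1 (levelRaise N k g)) 0 := by
    rw [← hW]
    exact ModularFormClass.analyticAt_cuspFunction_zero W one_pos h1
  exact qExpansion_mul hana (ModularFormClass.analyticAt_cuspFunction_zero CuspForm.discriminant one_pos
    one_mem_strictPeriods_SL)

end Cusp

end Literature.NumberTheory.ModularForms

end
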